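/-
Origin: expansion seat `planner-pub-hodgecm-pv11-g9-0`, handover TWO rewrites: `^import Pv11g9\.` -> `import HodgeCM.PerL34.` (x1: `import Pv11g9.PrintedOpEndState` -> `import HodgeCM.PerL34.PrintedOpEndState`, my row 3 r29/r30 18f17d12) and `^import Pv02g7\.` -> `import HodgeCM.Automorphic.` (x1: `import Pv02g7.WeilThetaModelLinear` -> `import HodgeCM.Automorphic.WeilThetaModelLinear`, pv02-g7 #1 r29 af979bb6) ; after HodgeCM/PerL34/PrintedOpEndState.lean (pv1 (`HOME/pub-hodgecm-pv11-g9/lean/Pv11g9/PrintedLinEndState.lean`, md5 8f93ee24, 454 lines);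
landed by the gen-8 packager in gate run 30 as `HodgeCM/PerL34/PrintedLinEndState.lean` (import ^import Pv11g9\.PrintedOpEndState[ \t]*$→import HodgeCM.PerL34.PrintedOpEndState ×1; import ^import Pv02g7\.WeilThetaModelLinear[ \t]*$→import HodgeCM.Automorphic.WeilThetaModelLinear ×1).
-/
/-
Copyright: pub-hodgecm cell, unit pub-hodgecm-pv11-g9 (DAG-NODE PROVER #11, gen 9), node #4. Mathlib + tree only.
Origin / target: `HOME/pub-hodgecm-pv11-g9/lean/Pv11g9/PrintedLinEndState.lean` → `HodgeCM/PerL34/PrintedLinEndState.lean`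
(imports this seat's node #3 `Pv11g9.PrintedOpEndState` → tree `HodgeCM.PerL34.PrintedOpEndState`, rewrite `^import Pv11g9\.` ↦
`import HodgeCM.PerL34.`; and pv02-g7's `Pv02g7.WeilThetaModelLinear` (CLAIM-FINAL 12:27:21Z, af979bb6) → tree
`HodgeCM.Automorphic.WeilThetaModelLinear`, rewrite `^import Pv02g7\.` ↦ `import HodgeCM.Automorphic.`).
-/
import Summits.HodgeConjecture.HodgeCM.PerL34.PrintedOpEndState_2
import Summits.HodgeConjecture.HodgeCM.Automorphic.WeilThetaModelLinear_2

/-!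
# N29 on the END STATE of a LINEAR Weil theta model: node #1's four `𝒮^κ`-structure fields are theorems

PerL v5 (tex blob d912a121), l. 341: "$\cS=\cS((V_3\otimes W)(\A))$ denotes the full Schwartz--Bruhat space … on which
$\omega=\omega_{W,\mu_W}$ is a continuous representation"; l. 344–345: "$\cS^\kappa$ the $\kappa$-isotypic subspace of
$\cS$"; [We64] n° 11/29 (S(X_A) a topological vector space), n° 37 (each `Φ ↦ SΦ` a unitary, in particular linear,
operator), n° 41 (`Θ(S) = Σ_ξ (SΦ)(ξ)`, linear in `Φ`).  In the tree this linear structure is NOT part of the Literature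
interface `WeilThetaDatum` (topology only on `SX`; GAPS pv11g9-A3); pv02-g7's `WeilThetaModel.LinearStr M` (RUN 29) carries
it as a Prop-free class at the level of Weil's datum — instances `AddCommGroup ↥M.SK`, `Module ℂ ↥M.SK`, and the operator
identities `opTC_θ_add` / `opTC_θ_smul` — with instances on every constructed model (Schrödinger, genuine, K-finite).

THIS LEAF (division of labour agreed with pv02-g7, STATUS 12:26:09Z / 12:27:21Z): on the END STATE
`T∘ := ThetaModel.ofRegCarrier (C.rtc R12 R34) hA` of a core whose Weil theta models `C.wm V c` are LINEAR
(`[(C.wm V c).LinearStr]`), node #1's four interface-blocked S4 fields are THEOREMS — `skAddCommGroup`, `skModule`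
(instances on `T∘.SK V c = ↥(C.wm V c).SK`), `TΦc_add_of_linear`, `TΦc_smul_of_linear` (pv02-g7 `opTC_θ_add/smul` through
node #2's `rfl` dictionary `𝒯_Φ = opTC (θ_Φ) ν`) — so the end-state input `occ` becomes, per good context and pair, a kind
map, scalings and a SIXTEEN-field `ArchC.LinearSide` (node #1's `ModelAnalyticSide` minus `instSKacg`, `instSKmod`,
`TΦc_add`, `TΦc_smul`; the `𝒮^κ` structure is an instance PARAMETER): `LinPrintedCore12/34`, `toPrinted` (node #1's record,
all twenty fields supplied), `toOp` (node #3's), `H_occ`, **`Open_occ_of_linPrintedCores`**, `N29_occ_of_linPrintedCores`;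
§3 on prl1-g5's `C₀.thetaModel h d12 d34`; §4 `Assembly.perL_ofSignRecipe₀_linPrintedCores : … → U.PerL` (+ realisationExists,
COR_CM).  Generic §1: `ArchC.LinearSide`, `LinearSide.toModel` / `toOp`, `ModelAnalyticSide.toLinear`.

HONEST LABEL.  CONDITIONAL DISCHARGE + RELOCATION: the four fields are discharged for every model that carries
pv02-g7's `LinearStr` (print-shaped structure laws, theorems on the constructed models — not an assumption about PerL);
what remains OPEN per good context and pair is the sixteen [SETUP D4/D5/D7] statements of `LinearSide` (node #3's
operator-side eighteen are implied by them, `LinPrintedCore12.toOp`).  Nothing of N29's archimedean content is proved.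
Asserts nothing: no new constants, no `axiom`, complete proofs.
-/

set_option autoImplicit false

noncomputable section

open MeasureTheory

namespace HodgeCM

/-! ## §1  The sixteen-field LINEAR side (generic) -/

namespace PerL34
namespace ArchC

open HodgeCM.Prior.Perl34File HodgeCM.Prior.Perl34File.Perl34
open HodgeCM.PerL34.Fock HodgeCM.PerL34.Fock.PrintDict

section Lin

variable {H HG CG G SK SigIdx SigIdxG : Type*}
variable [NormedAddCommGroup H] [InnerProductSpace ℂ H] [CompleteSpace H]
variable [NormedAddCommGroup HG] [InnerProductSpace ℂ HG] [CompleteSpace HG]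
variable [NormedAddCommGroup CG] [NormedSpace ℂ CG]
variable [Group G] [TopologicalSpace G] [TopologicalSpace SK]

/-- **The linear printed analytic side**: node #1's `ModelAnalyticSide` MINUS the four fields `instSKacg`, `instSKmod`,
`TΦc_add`, `TΦc_smul`; the ℂ-vector-space structure of `𝒮^κ` is an instance PARAMETER (on the end state of a linear Weil
theta model: pv02-g7's instances).  SIXTEEN fields, verbatim. -/
structure LinearSide (C : IsolationCore H HG CG G SK SigIdx SigIdxG) (P : C4a.PointedCore C)
    (RP : Type) [Fintype RP] [DecidableEq RP] (kind : RP → PlaceKind) (lam : RP → ℂ)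
    (hlam : ∀ b, lam b ≠ 0) (vac : RP → (Circle × Circle →* Circle))
    (ιT : (printPlaces RP kind lam hlam vac).Tg →* G) [AddCommGroup SK] [Module ℂ SK] where
  /-- [SETUP D4] index of the fixed data at the other places: Φ_f ∈ 𝒮((V₃⊗W)(𝔸_f)). -/
  FinIdx : Type
  /-- [SETUP D4] the pure tensor φ ↦ φ ⊗ Φ_f ∈ 𝒮^κ, linear in φ ∈ 𝓕^κ_∞. -/
  ins : FinIdx → (printPlaces RP kind lam hlam vac).F →ₗ[ℂ] SK
  /-- [SETUP D4/D5] the pure tensors span a dense subspace of 𝒮^κ (Reed–Simon I Thm V.13). -/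
  dense : Dense (Submodule.span ℂ
    (Set.range fun q : FinIdx × (printPlaces RP kind lam hlam vac).F => ins q.1 q.2) : Set SK)
  /-- [SETUP D4] ω(t)(φ ⊗ Φ_f) = (ω_∞(t)φ) ⊗ Φ_f (printed scalings, PINNED vacuum characters). -/
  omg_ins : ∀ (f : FinIdx) (t : (printPlaces RP kind lam hlam vac).Tg) (φ : (printPlaces RP kind lam hlam vac).F),
    C.omg (ιT t) (ins f φ) = ins f ((printPlaces RP kind lam hlam vac).ωT t φ)
  /-- [SETUP D5] index of a family of REAL directions X_j ∈ 𝔲(W)(L₀⊗ℝ). -/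
  ιR : Type
  /-- [SETUP D5] ω_∞(X_j) on 𝓕^κ_∞. -/
  XR : ιR → (printPlaces RP kind lam hlam vac).F →ₗ[ℂ] (printPlaces RP kind lam hlam vac).F
  /-- [SETUP D4] the one-parameter subgroups e_j(s) = exp(sX_j). -/
  e : ιR → ℝ → G
  /-- [SETUP D4] e_j(0) = 1. -/
  he : ∀ j, e j 0 = 1
  /-- [SETUP D5] every printed slot / ladder operator is a ℂ-combination of the real directions. -/
  ladder_span : ∀ k : (printPlaces RP kind lam hlam vac).ιX,
    (printPlaces RP kind lam hlam vac).X k ∈ Submodule.span ℂ (Set.range XR)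
  /-- [SETUP D5′] derivative of s ↦ 𝒯_{ω(e_j s)(φ⊗Φ_f)}(·)(g) at 0 in operator norm — s ↦ ω(e_j s)(φ⊗Φ_f) differentiable
  at 0 in the topology of 𝒮^κ in which Φ ↦ 𝒯_Φ(·)(g) is continuous (Schwartz / Fréchet, NOT L²): Poulsen 1972 (J. Funct.
  Anal. 9) Prop. 1.2, p. 93 + identification of Goodman's D_∞ topology on 𝒮 with the Schwartz topology (locator to be
  named, adv2g34-O14); Folland 1989 Thm. (4.45) / Prop. (4.49) only for the VALUE dω(X_j). -/
  hF : ∀ (j : ιR) (f : FinIdx) (φ : (printPlaces RP kind lam hlam vac).F) (p : P.Pt),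
    HasDerivAt (fun s : ℝ => C4a.pointFunctional C P (C.omg (e j s) (ins f φ)) p)
      (C4a.pointFunctional C P (ins f (XR j φ)) p) 0
  /-- [SETUP D7] the smooth (Gårding) vectors of σ̂_i. -/
  Sm : SigIdx → Set H
  /-- [SETUP D7] smooth vectors lie in σ̂_i. -/
  Sm_sub : ∀ i, Sm i ⊆ (C.hatσ i : Set H)
  /-- [SETUP D7] smooth vectors are dense in σ̂_i. -/
  Sm_dense : ∀ i, (C.hatσ i : Set H) ⊆ closure (Sm i)
  /-- [SETUP D7] the derived action dR(X_j) on smooth vectors. -/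
  YR : ιR → H → H
  /-- [SETUP D7] smooth vectors are stable under dR(X_j). -/
  YR_mem : ∀ (j : ιR) (i : SigIdx), ∀ v ∈ Sm i, YR j v ∈ Sm i
  /-- [SETUP D7] s ↦ R(e_j s)v is differentiable at 0 with derivative dR(X_j)v on smooth vectors. -/
  hH : ∀ (j : ιR) (i : SigIdx), ∀ v ∈ Sm i, HasDerivAt (fun s : ℝ => C.R (e j s) v) (YR j v) 0

variable {C : IsolationCore H HG CG G SK SigIdx SigIdxG} {P : C4a.PointedCore C}
variable {RP : Type} [Fintype RP] [DecidableEq RP] {kind : RP → PlaceKind} {lam : RP → ℂ} {hlam : ∀ b, lam b ≠ 0}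
  {vac : RP → (Circle × Circle →* Circle)} {ιT : (printPlaces RP kind lam hlam vac).Tg →* G}

/-- Node #1's twenty-field record from the linear side plus the two linearity laws of `Φ ↦ 𝒯_Φ`. -/
def LinearSide.toModel [AddCommGroup SK] [Module ℂ SK] (A : LinearSide C P RP kind lam hlam vac ιT)
    (TΦc_add : ∀ Φ Ψ : SK, C.TΦc (Φ + Ψ) = C.TΦc Φ + C.TΦc Ψ)
    (TΦc_smul : ∀ (c : ℂ) (Φ : SK), C.TΦc (c • Φ) = c • C.TΦc Φ) :
    ModelAnalyticSide C P RP kind lam hlam vac ιT where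
  TΦc_add := TΦc_add
  TΦc_smul := TΦc_smul
  FinIdx := A.FinIdx
  ins := A.ins
  dense := A.dense
  omg_ins := A.omg_ins
  ιR := A.ιR
  XR := A.XR
  e := A.e
  he := A.he
  ladder_span := A.ladder_span
  hF := A.hF
  Sm := A.Sm
  Sm_sub := A.Sm_sub
  Sm_dense := A.Sm_dense
  YR := A.YR
  YR_mem := A.YR_mem
  hH := A.hH

/-- Node #3's operator-side record from the linear side, the two linearity laws and operator-norm continuity. -/
def LinearSide.toOp [AddCommGroup SK] [Module ℂ SK] (A : LinearSide C P RP kind lam hlam vac ιT)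
    (TΦc_add : ∀ Φ Ψ : SK, C.TΦc (Φ + Ψ) = C.TΦc Φ + C.TΦc Ψ)
    (TΦc_smul : ∀ (c : ℂ) (Φ : SK), C.TΦc (c • Φ) = c • C.TΦc Φ)
    (hTc : Continuous fun Φ : SK => C.TΦc Φ) : OpAnalyticSide C P RP kind lam hlam vac ιT :=
  (A.toModel TΦc_add TΦc_smul).toOp hTc

/-- Conversely, node #1's record IS a linear side for its own structure fields (read-back). -/
def ModelAnalyticSide.toLinear (A : ModelAnalyticSide C P RP kind lam hlam vac ιT) :
    @LinearSide H HG CG G SK SigIdx SigIdxG _ _ _ _ _ _ _ _ _ _ _ C P RP _ _ kind lam hlam vac ιT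
      A.instSKacg A.instSKmod :=
  letI : AddCommGroup SK := A.instSKacg
  letI : Module ℂ SK := A.instSKmod
  { FinIdx := A.FinIdx
    ins := A.ins
    dense := A.dense
    omg_ins := A.omg_ins
    ιR := A.ιR
    XR := A.XR
    e := A.e
    he := A.he
    ladder_span := A.ladder_span
    hF := A.hF
    Sm := A.Sm
    Sm_sub := A.Sm_sub
    Sm_dense := A.Sm_dense
    YR := A.YR
    YR_mem := A.YR_mem
    hH := A.hH }

end Lin

end ArchC
end PerL34

/-! ## §2  On the END STATE of a LINEAR Weil theta model -/

namespace Universe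

namespace AdelicTorusCore

open HodgeCM.PerL34 HodgeCM.PerL34.ArchC HodgeCM.PerL34.Fock HodgeCM.PerL34.Fock.PrintDict
open HodgeCM.Prior.Perl34File HodgeCM.Prior.Perl34File.Perl34
open NumberField NumberField.SeesawArchTorus

variable {U : Universe} {hP : PrintFact_unitaryCompact} (C : U.AdelicTorusCore hP)
  (R12 : ∀ {L : CMField} {ι₁ : L →+* ℂ} (V : HermSpace3 L ι₁) (c : SeesawCtx L), C.Rest12 V c)
  (R34 : ∀ {L : CMField} {ι₁ : L →+* ℂ} (V : HermSpace3 L ι₁) (c : SeesawCtx L), C.Rest34 V c)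
  (hA : (C.rtc R12 R34).Analytic)

section Linear

variable {L : CMField} {ι₁ : L →+* ℂ} (V : HermSpace3 L ι₁) (c : SeesawCtx L)

/-- **The S4 field `instSKacg` on the END STATE of a linear Weil theta model (INSTANCE)**: `𝒮^κ = ↥(C.wm V c).SK` is an
additive commutative group (pv02-g7 `WeilThetaModel.instAddCommGroupSK`). -/
instance skAddCommGroup [(C.wm V c).LinearStr] :
    AddCommGroup ((ThetaModel.ofRegCarrier (C.rtc R12 R34) hA).SK V c) :=
  inferInstanceAs (AddCommGroup ↥(C.wm V c).SK)

/-- **The S4 field `instSKmod` on the END STATE of a linear Weil theta model (INSTANCE)**: `𝒮^κ` is a ℂ-vector space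
(pv02-g7 `WeilThetaModel.instModuleSK`). -/
instance skModule [(C.wm V c).LinearStr] :
    Module ℂ ((ThetaModel.ofRegCarrier (C.rtc R12 R34) hA).SK V c) :=
  inferInstanceAs (Module ℂ ↥(C.wm V c).SK)

/-- **The S4 field `TΦc_add` on the END STATE of a linear Weil theta model (KERNEL)**: `𝒯_{Φ+Ψ} = 𝒯_Φ + 𝒯_Ψ` —
pv02-g7 `WeilThetaModel.opTC_θ_add` through node #2's `rfl` dictionary `𝒯_Φ = opTC (θ_Φ) ν`. -/
theorem TΦc_add_of_linear [(C.wm V c).LinearStr] (Φ Ψ : (ThetaModel.ofRegCarrier (C.rtc R12 R34) hA).SK V c) :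
    ((ThetaModel.ofRegCarrier (C.rtc R12 R34) hA).core V c).TΦc (Φ + Ψ) =
      ((ThetaModel.ofRegCarrier (C.rtc R12 R34) hA).core V c).TΦc Φ +
        ((ThetaModel.ofRegCarrier (C.rtc R12 R34) hA).core V c).TΦc Ψ :=
  (C.wm V c).opTC_θ_add (c.D.latticeModelW hP).toQuotientModel.ν Φ Ψ

/-- **The S4 field `TΦc_smul` on the END STATE of a linear Weil theta model (KERNEL)**: `𝒯_{aΦ} = a • 𝒯_Φ`. -/
theorem TΦc_smul_of_linear [(C.wm V c).LinearStr] (a : ℂ) (Φ : (ThetaModel.ofRegCarrier (C.rtc R12 R34) hA).SK V c) :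
    ((ThetaModel.ofRegCarrier (C.rtc R12 R34) hA).core V c).TΦc (a • Φ) =
      a • ((ThetaModel.ofRegCarrier (C.rtc R12 R34) hA).core V c).TΦc Φ :=
  (C.wm V c).opTC_θ_smul (c.D.latticeModelW hP).toQuotientModel.ν a Φ

end Linear

section OpenOcc

/-- **The (12) LINEAR printed core of a context on the END STATE of a linear Weil theta model**: a kind map, scalings, and
a sixteen-field `LinearSide` over `T∘.core V c` (for pv02-g7's vector-space structure on `𝒮^κ`) at the canonical points
and the canonical (12) chart. -/
structure LinPrintedCore12 {L : CMField} {ι₁ : L →+* ℂ} (V : HermSpace3 L ι₁) (c : SeesawCtx L)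
    [ℓ : (C.wm V c).LinearStr] where
  /-- decidable equality of the infinite places (any instance; used only to form the printed places) -/
  [decEq : DecidableEq (InfinitePlace (L : Type))]
  /-- the kind `Σ₁₂ / D₁₂ / ι₁` of each infinite place -/
  kind : InfinitePlace (L : Type) → PlaceKind
  /-- the printed scalings `λ_b ≠ 0` -/
  lam : InfinitePlace (L : Type) → ℂ
  hlam : ∀ w, lam w ≠ 0
  /-- the linear analytic side at the canonical points and the canonical (12) chart -/
  side : LinearSide ((ThetaModel.ofRegCarrier (C.rtc R12 R34) hA).core V c) (C.pointedCore R12 R34 hA V c)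
    (InfinitePlace (L : Type)) kind lam hlam (pinnedVacs kind (R12 V c).m₁ (R12 V c).m₂)
    (C.chart12 R12 V c kind lam hlam)

/-- **The (34) LINEAR printed core of a context on the END STATE of a linear Weil theta model.** -/
structure LinPrintedCore34 {L : CMField} {ι₁ : L →+* ℂ} (V : HermSpace3 L ι₁) (c : SeesawCtx L)
    [ℓ : (C.wm V c).LinearStr] where
  [decEq : DecidableEq (InfinitePlace (L : Type))]
  kind : InfinitePlace (L : Type) → PlaceKind
  lam : InfinitePlace (L : Type) → ℂ
  hlam : ∀ w, lam w ≠ 0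
  side : LinearSide ((ThetaModel.ofRegCarrier (C.rtc R12 R34) hA).core V c) (C.pointedCore R12 R34 hA V c)
    (InfinitePlace (L : Type)) kind lam hlam (pinnedVacs kind (R34 V c).m₁ (R34 V c).m₂)
    (C.chart34 R34 V c kind lam hlam)

namespace LinPrintedCore12

variable {C R12 R34 hA} {L : CMField} {ι₁ : L →+* ℂ} {V : HermSpace3 L ι₁} {c : SeesawCtx L}

/-- **Node #1's printed core (all TWENTY fields) from the linear one**: the four structure fields := `skAddCommGroup`,
`skModule`, `TΦc_add_of_linear`, `TΦc_smul_of_linear`. -/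
def toPrinted [ℓ : (C.wm V c).LinearStr] (A : LinPrintedCore12 C R12 R34 hA V c) : PrintedCore12 C R12 R34 hA V c :=
  letI := A.decEq
  { decEq := A.decEq
    kind := A.kind
    lam := A.lam
    hlam := A.hlam
    side := A.side.toModel (C.TΦc_add_of_linear R12 R34 hA V c) (C.TΦc_smul_of_linear R12 R34 hA V c) }

/-- Node #3's operator-side printed core from the linear one. -/
def toOp [ℓ : (C.wm V c).LinearStr] (A : LinPrintedCore12 C R12 R34 hA V c) : OpPrintedCore12 C R12 R34 hA V c :=
  OpPrintedCore12.ofPrinted A.toPrinted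

/-- **Lemma 4.1(c), pair (12), on the END STATE of a linear Weil theta model from the linear printed core alone.** -/
theorem H_occ [ℓ : (C.wm V c).LinearStr] (A : LinPrintedCore12 C R12 R34 hA V c) :
    ∀ (Φ : (ThetaModel.ofRegCarrier (C.rtc R12 R34) hA).SK V c)
      (i : (ThetaModel.ofRegCarrier (C.rtc R12 R34) hA).SigIdx V c),
      (∃ v ∈ ((ThetaModel.ofRegCarrier (C.rtc R12 R34) hA).core V c).hatσ i,
        ((ThetaModel.ofRegCarrier (C.rtc R12 R34) hA).core V c).TΦ Φ v ≠ 0) →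
      ((ThetaModel.ofRegCarrier (C.rtc R12 R34) hA).t12 V c).wOccurs i :=
  A.toPrinted.H_occ

end LinPrintedCore12

namespace LinPrintedCore34

variable {C R12 R34 hA} {L : CMField} {ι₁ : L →+* ℂ} {V : HermSpace3 L ι₁} {c : SeesawCtx L}

/-- Node #1's (34) printed core from the linear one. -/
def toPrinted [ℓ : (C.wm V c).LinearStr] (A : LinPrintedCore34 C R12 R34 hA V c) : PrintedCore34 C R12 R34 hA V c :=
  letI := A.decEq
  { decEq := A.decEq
    kind := A.kind
    lam := A.lam
    hlam := A.hlam
    side := A.side.toModel (C.TΦc_add_of_linear R12 R34 hA V c) (C.TΦc_smul_of_linear R12 R34 hA V c) }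

/-- Node #3's (34) operator-side printed core from the linear one. -/
def toOp [ℓ : (C.wm V c).LinearStr] (A : LinPrintedCore34 C R12 R34 hA V c) : OpPrintedCore34 C R12 R34 hA V c :=
  OpPrintedCore34.ofPrinted A.toPrinted

/-- **Lemma 4.1(c), pair (34), on the END STATE of a linear Weil theta model from the linear printed core alone.** -/
theorem H_occ [ℓ : (C.wm V c).LinearStr] (A : LinPrintedCore34 C R12 R34 hA V c) :
    ∀ (Φ : (ThetaModel.ofRegCarrier (C.rtc R12 R34) hA).SK V c)
      (i : (ThetaModel.ofRegCarrier (C.rtc R12 R34) hA).SigIdx V c),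
      (∃ v ∈ ((ThetaModel.ofRegCarrier (C.rtc R12 R34) hA).core V c).hatσ i,
        ((ThetaModel.ofRegCarrier (C.rtc R12 R34) hA).core V c).TΦ Φ v ≠ 0) →
      ((ThetaModel.ofRegCarrier (C.rtc R12 R34) hA).t34 V c).wOccurs i :=
  A.toPrinted.H_occ

end LinPrintedCore34

/-- **`Open_occ` (N29, BOTH torus sides) of the END-STATE theta model of a core with LINEAR Weil theta models, from
sixteen-field linear printed data per good context and pair.** -/
theorem Open_occ_of_linPrintedCores
    (lin : ∀ {L : CMField} {ι₁ : L →+* ℂ} (V : HermSpace3 L ι₁) (c : SeesawCtx L), (C.wm V c).LinearStr)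
    (A12 : ∀ {L : CMField} {ι₁ : L →+* ℂ} (V : HermSpace3 L ι₁) (c : SeesawCtx L),
      (ThetaModel.ofRegCarrier (C.rtc R12 R34) hA).GoodCtx ι₁ c →
        Nonempty (C.LinPrintedCore12 R12 R34 hA V c (ℓ := lin V c)))
    (A34 : ∀ {L : CMField} {ι₁ : L →+* ℂ} (V : HermSpace3 L ι₁) (c : SeesawCtx L),
      (ThetaModel.ofRegCarrier (C.rtc R12 R34) hA).GoodCtx ι₁ c →
        Nonempty (C.LinPrintedCore34 R12 R34 hA V c (ℓ := lin V c))) :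
    (ThetaModel.ofRegCarrier (C.rtc R12 R34) hA).Open_occ :=
  fun V c hc => ⟨fun Φ i h => (A12 V c hc).elim fun A => A.H_occ (ℓ := lin V c) Φ i h,
    fun Φ i h => (A34 V c hc).elim fun A => A.H_occ (ℓ := lin V c) Φ i h⟩

/-- **N29 BY THE CARVER'S NAME** on the end state of a core with linear Weil theta models. -/
theorem N29_occ_of_linPrintedCores
    (lin : ∀ {L : CMField} {ι₁ : L →+* ℂ} (V : HermSpace3 L ι₁) (c : SeesawCtx L), (C.wm V c).LinearStr)
    (A12 : ∀ {L : CMField} {ι₁ : L →+* ℂ} (V : HermSpace3 L ι₁) (c : SeesawCtx L),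
      (ThetaModel.ofRegCarrier (C.rtc R12 R34) hA).GoodCtx ι₁ c →
        Nonempty (C.LinPrintedCore12 R12 R34 hA V c (ℓ := lin V c)))
    (A34 : ∀ {L : CMField} {ι₁ : L →+* ℂ} (V : HermSpace3 L ι₁) (c : SeesawCtx L),
      (ThetaModel.ofRegCarrier (C.rtc R12 R34) hA).GoodCtx ι₁ c →
        Nonempty (C.LinPrintedCore34 R12 R34 hA V c (ℓ := lin V c))) :
    N29_occ (ThetaModel.ofRegCarrier (C.rtc R12 R34) hA) :=
  C.Open_occ_of_linPrintedCores R12 R34 hA lin A12 A34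

end OpenOcc

end AdelicTorusCore

/-! ## §3  The same for the sign-recipe end state `C₀.thetaModel h d12 d34` (prl1-g5) -/

namespace AdelicThetaCore

open HodgeCM.PerL34

variable {U : Universe} {hP : PrintFact_unitaryCompact} (C₀ : U.AdelicThetaCore hP) (h : Bool)
  (d12 d34 : ∀ {L : CMField}, SeesawCtx L → SideData L)

/-- **`Open_occ` of prl1-g5's END-STATE model `C₀.thetaModel h d12 d34` with LINEAR Weil theta models** from the linear
printed cores of its contexts. -/
theorem Open_occ_thetaModel_of_linPrintedCores
    (lin : ∀ {L : CMField} {ι₁ : L →+* ℂ} (V : HermSpace3 L ι₁) (c : SeesawCtx L), ((C₀.toCore h).wm V c).LinearStr)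
    (A12 : ∀ {L : CMField} {ι₁ : L →+* ℂ} (V : HermSpace3 L ι₁) (c : SeesawCtx L),
      (C₀.thetaModel h d12 d34).GoodCtx ι₁ c →
        Nonempty ((C₀.toCore h).LinPrintedCore12 ((C₀.toCore h).side12 d12) ((C₀.toCore h).side34 d34)
          ((C₀.toCore h).analyticKM ((C₀.toCore h).side12 d12) ((C₀.toCore h).side34 d34)).toAnalytic V c
          (ℓ := lin V c)))
    (A34 : ∀ {L : CMField} {ι₁ : L →+* ℂ} (V : HermSpace3 L ι₁) (c : SeesawCtx L),
      (C₀.thetaModel h d12 d34).GoodCtx ι₁ c →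
        Nonempty ((C₀.toCore h).LinPrintedCore34 ((C₀.toCore h).side12 d12) ((C₀.toCore h).side34 d34)
          ((C₀.toCore h).analyticKM ((C₀.toCore h).side12 d12) ((C₀.toCore h).side34 d34)).toAnalytic V c
          (ℓ := lin V c))) :
    (C₀.thetaModel h d12 d34).Open_occ :=
  (C₀.toCore h).Open_occ_of_linPrintedCores _ _ _ lin A12 A34

end AdelicThetaCore

end Universe

/-! ## §4  The binder-minimal END STATES with `occ` from linear printed cores -/

namespace Assembly

open HodgeCM.PerL34
open HodgeCM.Prior.Perl34File HodgeCM.Prior.Perl34File.Perl34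
open HodgeCM.Universe (AdelicThetaCore AdelicThetaCore₀ AdelicTorusCore SideData ThetaModel)

variable (U : Universe)


-- port_pkg: scope closed for this part
end Assembly
end HodgeCM
end
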